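import Literature.AlgebraicGeometry.Resolution.LocalBlowup
import HarnessLib

/-!
# StableRestrict — restricting a finite automorphism family to a stable subfield (two-storey bookkeeping, STEP C₀)
(decomp-res lens-1 g28 preparation H; NEXT-g29-E §2 STEP C₀)

The invariant-descent engine (`Theorems/InvariantDescentLU*.lean`) is stated over a field `E` with a finite family `H` of ring
automorphisms of `E`.  In the two-storey tame cell the relevant field is the INERTIA FIELD `K_T ⊆ K′` and the group
acting on it is the image of
the whole group `G ≤ Aut K′`.  This file is the transfer kit: for a subfield `F ⊆ E` stable under `g` (`x ∈ F ↔ g x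
∈ F`) the restriction
`restrict F g _ : F ≃+* F`; the image family `imageRestrict F G _ : Finset (F ≃+* F)` (contains `1`, closed under
`*`, fixed points = `G`-fixed
points of `F`); the induced valuation ring `O.comap F.subtype` (membership and the predicates `v < 1`, `v = 1` agree
with those of `O`); and the
transport of `locAtCentre` along `F ⊆ E` as a ring isomorphism, so that regularity statements pass between the two frames
(`IsRegularLocalRing.of_ringEquiv`).  All [folklore].
-/

open Literature.AlgebraicGeometry.Resolution

namespace Summit.ResolutionOfSingularities.ResolutionOfSingularities.Theorems.StableRestrict

universe u

variable {E : Type u} [Field E]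

/-! ### S1. Restriction of a stabilising automorphism -/

/-- `g (g⁻¹ x) ∈ F`-bookkeeping: the inverse of a stabilising automorphism stabilises. [folklore] -/
theorem symm_apply_mem_iff (F : Subfield E) (g : E ≃+* E) (hF : ∀ x, x ∈ F ↔ g x ∈ F) (x : E) :
    x ∈ F ↔ g.symm x ∈ F := by
  rw [hF (g.symm x), RingEquiv.apply_symm_apply]

/-- The restriction of a stabilising ring automorphism of `E` to the stable subfield `F`. [folklore] -/
def restrict (F : Subfield E) (g : E ≃+* E) (hF : ∀ x, x ∈ F ↔ g x ∈ F) : F ≃+* F where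
  toFun x := ⟨g x, (hF x).mp x.2⟩
  invFun x := ⟨g.symm x, (symm_apply_mem_iff F g hF x).mp x.2⟩
  left_inv x := Subtype.ext (by simp)
  right_inv x := Subtype.ext (by simp)
  map_mul' x y := Subtype.ext (by simp)
  map_add' x y := Subtype.ext (by simp)

/-- `coe_restrict_apply`: Auxiliary step of this node's calculus, VERBATIM from the lens file (see the module
docstring); the statement is its type. [folklore] -/
@[simp] theorem coe_restrict_apply (F : Subfield E) (g : E ≃+* E) (hF : ∀ x, x ∈ F ↔ g x ∈ F) (x : F) :
    ((restrict F g hF x : F) : E) = g x := rfl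

/-- Stability is closed under composition. [folklore] -/
theorem stable_mul {F : Subfield E} {g h : E ≃+* E} (hg : ∀ x, x ∈ F ↔ g x ∈ F) (hh : ∀ x, x ∈ F ↔ h x ∈ F) :
    ∀ x, x ∈ F ↔ (g * h) x ∈ F := fun x => by
  rw [RingAut.mul_apply, ← hg, ← hh]

/-- `1` stabilises. [folklore] -/
theorem stable_one (F : Subfield E) : ∀ x, x ∈ F ↔ (1 : E ≃+* E) x ∈ F := fun _ => Iff.rfl

/-- `restrict_mul`: Auxiliary step of this node's calculus, VERBATIM from the lens file (see the module docstring);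
the statement is its type. [folklore] -/
theorem restrict_mul {F : Subfield E} {g h : E ≃+* E} (hg : ∀ x, x ∈ F ↔ g x ∈ F) (hh : ∀ x, x ∈ F ↔ h x ∈ F) :
    restrict F (g * h) (stable_mul hg hh) = restrict F g hg * restrict F h hh :=
  RingEquiv.ext fun _ => Subtype.ext rfl

/-- `restrict_one`: Auxiliary step of this node's calculus, VERBATIM from the lens file (see the module docstring);
the statement is its type. [folklore] -/
theorem restrict_one (F : Subfield E) (h1 : ∀ x, x ∈ F ↔ (1 : E ≃+* E) x ∈ F) : restrict F 1 h1 = 1 :=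
  RingEquiv.ext fun _ => Subtype.ext rfl

/-- Proof-irrelevance of the stability witness. [folklore] -/
theorem restrict_congr {F : Subfield E} {g g' : E ≃+* E} (hg : ∀ x, x ∈ F ↔ g x ∈ F) (hg' : ∀ x, x ∈ F ↔ g' x ∈ F)
    (h : g = g') : restrict F g hg = restrict F g' hg' := by
  subst h; rfl

/-- A restriction is `1` iff `g` fixes `F` pointwise. [folklore] -/
theorem restrict_eq_one_iff {F : Subfield E} {g : E ≃+* E} (hg : ∀ x, x ∈ F ↔ g x ∈ F) :
    restrict F g hg = 1 ↔ ∀ x ∈ F, g x = x := by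
  constructor
  · intro h x hx
    have := congrArg (fun e : F ≃+* F => ((e ⟨x, hx⟩ : F) : E)) h
    simpa using this
  · intro h
    exact RingEquiv.ext fun x => Subtype.ext (by simpa using h x x.2)

/-! ### S2. The image family -/

/-- The image of a finite family `G` of automorphisms stabilising `F`, as a finite family of automorphisms of `F`. [folklore] -/
noncomputable def imageRestrict (F : Subfield E) (G : Finset (E ≃+* E)) (hG : ∀ g ∈ G, ∀ x, x ∈ F ↔ g x ∈ F) :
    Finset (F ≃+* F) := by
  classical
  exact G.attach.image fun g => restrict F g.1 (hG g.1 g.2)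

/-- `mem_imageRestrict_iff`: Auxiliary step of this node's calculus, VERBATIM from the lens file (see the module
docstring); the statement is its type. [folklore] -/
theorem mem_imageRestrict_iff {F : Subfield E} {G : Finset (E ≃+* E)} {hG : ∀ g ∈ G, ∀ x, x ∈ F ↔ g x ∈ F}
    {e : F ≃+* F} : e ∈ imageRestrict F G hG ↔ ∃ g, ∃ hg : g ∈ G, restrict F g (hG g hg) = e := by
  classical
  unfold imageRestrict
  simp only [Finset.mem_image, Finset.mem_attach, true_and, Subtype.exists]

/-- `restrict_mem_imageRestrict`: Auxiliary step of this node's calculus, VERBATIM from the lens file (see the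
module docstring); the statement is its type. [folklore] -/
theorem restrict_mem_imageRestrict {F : Subfield E} {G : Finset (E ≃+* E)} (hG : ∀ g ∈ G, ∀ x, x ∈ F ↔ g x ∈ F)
    {g : E ≃+* E} (hg : g ∈ G) : restrict F g (hG g hg) ∈ imageRestrict F G hG :=
  mem_imageRestrict_iff.mpr ⟨g, hg, rfl⟩

/-- A property holds on the image family iff it holds for every restriction. [folklore] -/
theorem forall_mem_imageRestrict_iff {F : Subfield E} {G : Finset (E ≃+* E)} {hG : ∀ g ∈ G, ∀ x, x ∈ F ↔ g x ∈ F}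
    {P : (F ≃+* F) → Prop} : (∀ e ∈ imageRestrict F G hG, P e) ↔ ∀ g, ∀ hg : g ∈ G, P (restrict F g (hG g hg)) := by
  constructor
  · intro h g hg; exact h _ (restrict_mem_imageRestrict hG hg)
  · intro h e he
    obtain ⟨g, hg, rfl⟩ := mem_imageRestrict_iff.mp he
    exact h g hg

/-- `1 ∈ G ⇒ 1 ∈ G|_F`. [folklore] -/
theorem one_mem_imageRestrict {F : Subfield E} {G : Finset (E ≃+* E)} (hG : ∀ g ∈ G, ∀ x, x ∈ F ↔ g x ∈ F)
    (h1 : (1 : E ≃+* E) ∈ G) : (1 : F ≃+* F) ∈ imageRestrict F G hG := by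
  rw [← restrict_one F (hG 1 h1)]; exact restrict_mem_imageRestrict hG h1

/-- `G` closed under `*` ⇒ `G|_F` closed under `*`. [folklore] -/
theorem mul_mem_imageRestrict {F : Subfield E} {G : Finset (E ≃+* E)} (hG : ∀ g ∈ G, ∀ x, x ∈ F ↔ g x ∈ F)
    (hmul : ∀ a ∈ G, ∀ b ∈ G, a * b ∈ G) :
    ∀ a ∈ imageRestrict F G hG, ∀ b ∈ imageRestrict F G hG, a * b ∈ imageRestrict F G hG := by
  intro a ha b hb
  obtain ⟨g, hg, rfl⟩ := mem_imageRestrict_iff.mp ha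
  obtain ⟨h, hh, rfl⟩ := mem_imageRestrict_iff.mp hb
  rw [← restrict_mul]
  rw [restrict_congr (stable_mul (hG g hg) (hG h hh)) (hG _ (hmul g hg h hh)) rfl]
  exact restrict_mem_imageRestrict hG (hmul g hg h hh)

/-- Fixed points of `G|_F` = `G`-fixed points of `F`. [folklore] -/
theorem forall_imageRestrict_apply_eq_iff {F : Subfield E} {G : Finset (E ≃+* E)} (hG : ∀ g ∈ G, ∀ x, x ∈ F ↔ g x ∈ F)
    (z : F) : (∀ e ∈ imageRestrict F G hG, e z = z) ↔ ∀ g ∈ G, g (z : E) = z := by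
  rw [forall_mem_imageRestrict_iff]
  constructor
  · intro h g hg; have := congrArg (fun w : F => (w : E)) (h g hg); simpa using this
  · intro h g hg; exact Subtype.ext (by simpa using h g hg)

/-- Stability of a subring of `F` under `G|_F` = stability of its image under `G`. [folklore] -/
theorem forall_imageRestrict_mem_iff {F : Subfield E} {G : Finset (E ≃+* E)} (hG : ∀ g ∈ G, ∀ x, x ∈ F ↔ g x ∈ F)
    (S : Set F) : (∀ e ∈ imageRestrict F G hG, ∀ z ∈ S, e z ∈ S) ↔
      ∀ g, ∀ hg : g ∈ G, ∀ z ∈ S, (⟨g (z : E), (hG g hg z).mp z.2⟩ : F) ∈ S := by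
  rw [forall_mem_imageRestrict_iff]; exact Iff.rfl

/-- A non-identity element of `G|_F` comes from a `g ∈ G` moving some element of `F`. [folklore] -/
theorem exists_of_mem_imageRestrict_ne_one {F : Subfield E} {G : Finset (E ≃+* E)} (hG : ∀ g ∈ G, ∀ x, x ∈ F ↔ g x ∈ F)
    {e : F ≃+* F} (he : e ∈ imageRestrict F G hG) (hne : e ≠ 1) :
    ∃ g, ∃ hg : g ∈ G, restrict F g (hG g hg) = e ∧ ¬ ∀ x ∈ F, g x = x := by
  obtain ⟨g, hg, rfl⟩ := mem_imageRestrict_iff.mp he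
  exact ⟨g, hg, rfl, fun h => hne ((restrict_eq_one_iff _).mpr h)⟩

/-! ### S3. The induced valuation ring on `F` -/

/-- Membership in the induced valuation ring. [folklore] -/
theorem mem_comap_subtype_iff (O : ValuationSubring E) (F : Subfield E) (z : F) :
    z ∈ O.comap F.subtype ↔ (z : E) ∈ O := ValuationSubring.mem_comap

/-- `v z < 1 ↔ z = 0 ∨ z⁻¹ ∉ O`. [folklore] -/
theorem valuation_lt_one_iff {L : Type u} [Field L] (O : ValuationSubring L) (z : L) :
    O.valuation z < 1 ↔ z = 0 ∨ z⁻¹ ∉ O := by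
  by_cases hz : z = 0
  · subst hz; simp
  · rw [← O.valuation_le_one_iff, map_inv₀]
    have h0 : 0 < O.valuation z := (Valuation.pos_iff _).mpr hz
    rw [inv_le_one₀ h0, not_le]
    simp [hz]

/-- The predicate `v < 1` agrees on `F` and on `E`. [folklore] -/
theorem valuation_comap_lt_one_iff (O : ValuationSubring E) (F : Subfield E) (z : F) :
    (O.comap F.subtype).valuation z < 1 ↔ O.valuation (z : E) < 1 := by
  rw [valuation_lt_one_iff, valuation_lt_one_iff, ValuationSubring.mem_comap]
  simp

/-- The predicate `v = 1` agrees on `F` and on `E`. [folklore] -/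
theorem valuation_comap_eq_one_iff (O : ValuationSubring E) (F : Subfield E) (z : F) :
    (O.comap F.subtype).valuation z = 1 ↔ O.valuation (z : E) = 1 := by
  have h1 : (O.comap F.subtype).valuation z ≤ 1 ↔ O.valuation (z : E) ≤ 1 := by
    rw [ValuationSubring.valuation_le_one_iff, ValuationSubring.valuation_le_one_iff, ValuationSubring.mem_comap]; rfl
  have h2 := valuation_comap_lt_one_iff O F z
  constructor
  · intro h; exact le_antisymm (h1.mp h.le) (not_lt.mp fun h' => (h2.mpr h').ne h)
  · intro h; exact le_antisymm (h1.mpr h.le) (not_lt.mp fun h' => (h2.mp h').ne h)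

/-! ### S4. Transport of `locAtCentre` along `F ⊆ E` -/

/-- The image of `locAtCentre S (O|_F)` in `E` is `locAtCentre (S.map F.subtype) O`. [folklore] -/
theorem map_locAtCentre_comap (O : ValuationSubring E) (F : Subfield E) (S : Subring F) :
    (locAtCentre S (O.comap F.subtype)).map F.subtype = locAtCentre (S.map F.subtype) O := by
  ext x
  simp only [Subring.mem_map, mem_locAtCentre_iff]
  constructor
  · rintro ⟨w, ⟨y, hy, z, hz, hv, rfl⟩, rfl⟩
    refine ⟨y, ⟨y, hy, rfl⟩, z, ⟨z, hz, rfl⟩, (valuation_comap_eq_one_iff O F z).mp hv, ?_⟩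
    simp
  · rintro ⟨_, ⟨y, hy, rfl⟩, _, ⟨z, hz, rfl⟩, hv, rfl⟩
    refine ⟨y / z, ⟨y, hy, z, hz, (valuation_comap_eq_one_iff O F z).mpr (by simpa using hv), rfl⟩, ?_⟩
    simp

/-- `locAtCentre S (O|_F) ≃+* locAtCentre (S.map F.subtype) O`. [folklore] -/
noncomputable def locAtCentreComapEquiv (O : ValuationSubring E) (F : Subfield E) (S : Subring F) :
    locAtCentre S (O.comap F.subtype) ≃+* locAtCentre (S.map F.subtype) O :=
  ((locAtCentre S (O.comap F.subtype)).equivMapOfInjective F.subtype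
      (by exact Subtype.val_injective)).trans
    (RingEquiv.subringCongr (map_locAtCentre_comap O F S))

/-- Regularity passes between the two frames. [folklore] -/
theorem isRegularLocalRing_locAtCentre_comap_iff (O : ValuationSubring E) (F : Subfield E) (S : Subring F) :
    IsRegularLocalRing (locAtCentre S (O.comap F.subtype)) ↔
      IsRegularLocalRing (locAtCentre (S.map F.subtype) O) := by
  constructor
  · intro h; exact IsRegularLocalRing.of_ringEquiv (locAtCentreComapEquiv O F S)
  · intro h; exact IsRegularLocalRing.of_ringEquiv (locAtCentreComapEquiv O F S).symm

/-! ### S5. The separating clause transported to `F` -/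

/-- If every `g ∈ G` fixing `x ∈ F` fixes `F` pointwise, and every `g` moving `x` has `v(x − g x) = 1`, then every
non-identity element of
`G|_F` separates `x` residually — the hypothesis `hsep` of the invariant-descent engine in the frame `F`. [folklore] -/
theorem sep_imageRestrict (O : ValuationSubring E) {F : Subfield E} {G : Finset (E ≃+* E)}
    (hG : ∀ g ∈ G, ∀ x, x ∈ F ↔ g x ∈ F) (x : F)
    (hfix : ∀ g ∈ G, g (x : E) = x → ∀ y ∈ F, g y = y)
    (hsep : ∀ g ∈ G, g (x : E) ≠ x → O.valuation ((x : E) - g x) = 1) :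
    ∀ e ∈ imageRestrict F G hG, e ≠ 1 → (O.comap F.subtype).valuation (x - e x) = 1 := by
  intro e he hne
  obtain ⟨g, hg, rfl, hmov⟩ := exists_of_mem_imageRestrict_ne_one hG he hne
  have hgx : g (x : E) ≠ x := fun h => hmov (hfix g hg h)
  rw [valuation_comap_eq_one_iff]
  simpa using hsep g hg hgx

end Summit.ResolutionOfSingularities.ResolutionOfSingularities.Theorems.StableRestrict
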